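import Literature.NumberTheory.GaloisRepresentations.LubinTateUnramifiedTowerAmiceLevel
import Literature.NumberTheory.GaloisRepresentations.LubinTateColemanCoordModuleTwo
import Literature.NumberTheory.GaloisRepresentations.LubinTateColemanTwoVariableTwistTwo
import HarnessLib

/-!
# De Shalit's (17) at `q = 2` as an exact sequence of `Λ`-MODULES: the image of the two-variable Coleman transform is a
# `Λ`-SUBMODULE `N` of `M = (𝒪_F⟦X⟧⟦Y⟧)^{ℤ/d}`, `N ≅ 𝒰¹_∞` (principal norm-coherent units of the two-variable tower), and `M = N + 𝒪_F·G₀`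

De Shalit, *Iwasawa theory of elliptic curves with complex multiplication* (1987), Ch. I §3.7 Theorem, §3.8 (16)–(17); Ch. III §1.3:
`0 → 𝒰 ⊗̂ 𝒪 →ⁱ Λ(𝒢_a, 𝒪) →ʲ 𝒪(1) → 0`.  The lane has this at `q = 2` in FAMILY currency for the general unramified tower
`[E_m : F] = d·p^m`: the transform `Col β : ℤ/d → 𝒪_F⟦X⟧⟦Y⟧` (`existsUnique_colemanTransformProd₂`), injective on principal families, with
image `{G : the level-m constant terms of its coordinate family lie in (1 − uφ_m)𝒪_{E_m}}` (`exists_baseNormCoherent_principal_iff`) and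
cyclic cokernel (`exists_cokernel_generator_colemanTransformProd₂`).  THIS file turns it into MODULE THEORY over the two-variable algebra
`Λ = 𝒪_F⟦X⟧⟦T⟧` (`T ↦ D_γ`, `LubinTateColemanCoordModuleTwo`; `X = φ − 1` through the coefficients):

* §1 `IsTransformProd` (the transform congruences, = `∀ m k, IsAmiceLevel … (coeff_k ∘ G) (coeff_k r_m)`), `constTerm G` (the `Y`-constant
  terms `j ↦ G_j(Y = 0) ∈ 𝒪_F⟦X⟧`) with `constTerm_add/_C_smul`, ★ `constantCoeff_twistLinearBase` (`(D_γ H)(0) = (γ − 1)·H(0)`: `ρ_γ(0) = 1`,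
  `[γ](0) = 0`) hence `constTerm_X_smul` (`(T • G)⁰ = (γ − 1)·G⁰`), and `constantCoeff_mem_of_mem_adicFiltGen` (`H ∈ I_K ⟹ H(0) ∈ (π^K)`);
* §2 ★★★ **`unitsImage … : Submodule Λ (ℤ/d → ColemanCoordModule …)`** — carrier `{G : ∀ m, IsAdmissibleLevel … (hθ m) u (constTerm G)}`;
  the `Λ`-STABILITY is algebraic: `λ • G ≡ Σ_{k<K} C(λ_k)·D_γ^k G (mod I_K)` (`tAct_sub_tPartial_mem`), the finite part has constant terms
  `s·G⁰` with `s = Σ λ_k (γ−1)^k ∈ 𝒪_F⟦X⟧` (admissible by `IsAdmissibleLevel.C_mul`), and the remainder has constant terms in `(π^K)`,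
  admissible for `K` the level-`m` anomaly exponent (`exists_pow_smul_mem_anomalyRange`) — no topology on `𝒰`;
* §3 ★★ **`mem_unitsImage_iff_exists_principal`** — `G ∈ N` iff `G = Col β` for a (unique) baseNorm-coherent family `β` of PRINCIPAL
  norm-coherent units of the two-variable tower (`exists_baseNormCoherent_principal_iff` + the trace-coherent inverse of the transform);
* §4 ★★ **`exists_forall_sub_C_smul_mem_unitsImage`** — `∃ G₀ ∀ G ∃ a ∈ 𝒪_F, G − a·G₀ ∈ N` (`exists_cokernel_generator_colemanTransformProd₂`):
  **`M = N + 𝒪_F·G₀`**, the cokernel `M/N` is a cyclic `𝒪_F`-module (de Shalit's `𝒪(1)`), and `unitsImage_sup_span_eq_top`.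

So, as `Λ`-modules: `𝒰¹_∞ ≅ N ≤ M ≅ Λ^{2d}` (`coordBasis`) with `M/N` cyclic over `𝒪_F = Λ/(X, T)` — the input of every characteristic-ideal
computation with the semi-local units at `p = 2` (Yager's theorem at `2`, LTYZ 2025 Thm. 7.2).  Everything PROVED (0 sorry, no named facts);
definitions `IsTransformProd`, `constTerm`, `unitsImage`.  NOT here: the `Λ(𝒢)`-equivariance of `N` for the full group (`Δ`, the `ℤ/d`-shift
— the operators exist: `unitTwistₗ`, `colemanTransformProd₂_galois_eq`), pseudo-nullity of `M/N` as a `Λ`-module, the semi-local product.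

## References
* E. de Shalit, *Iwasawa theory of elliptic curves with complex multiplication* (1987), Ch. I §3.7 Theorem, §3.8 (16)–(17); Ch. III §1.3. [deShalit1987]
-/

noncomputable section

namespace Literature.NumberTheory.GaloisRepresentations
section UnitsImageModuleTwo

open GaloisRepresentations.IsNonarchimedeanLocalField LubinTate ValuativeRel Field Finset
open Literature.NumberTheory.EllipticCurves.IwasawaOmega

variable {F : Type} [Field F] [ValuativeRel F] [TopologicalSpace F] [IsNonarchimedeanLocalField F]

attribute [local instance] ltNormUniformSpace ltNormIsUniformAddGroup rk1 nF nE fintypeResidueField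

variable (p : ℕ) [hp : Fact p.Prime] (d : ℕ) (hd : d.Coprime p)
variable {π : 𝒪[F]} (hπ : (valuation F).IsUniformizer (π : F))
variable (E : ℕ → IntermediateField F (AlgebraicClosure F)) [∀ m, FiniteDimensional F (E m)] [∀ m, Normal F (E m)]
  [∀ m, IsGalois F (E m)] (hmono : Monotone E) (hE : ∀ m, E m ≤ maxUnramified F) (hdeg : ∀ m, Module.finrank F (E m) = d * p ^ m)
  (σ₀ : absoluteGaloisGroup F) (hσ₀ : IsAbsArithFrob σ₀)
variable (hq : residueFieldCard F = 2)

/-! ### §1. The transform predicate, constant terms -/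
variable {E} in
/-- **`IsTransformProd … hθ r G`**: `G : ℤ/d → 𝒪_F⟦X⟧⟦Y⟧` is the two-variable transform of the series family `r = (r_m ∈ 𝒪_{E_m}⟦Y⟧)_m`:
coefficientwise in `Y`, `(coeff_k ∘ G, coeff_k r_m)` is a level-`m` Amice pair for every `m, k` — the congruences of
`existsUnique_colemanTransformProd₂`, named. [cite: deShalit1987, Ch. I §3.8 (17)] -/
def IsTransformProd {θ : ∀ m, unitBall (E m)} (hθ : ∀ m, IsIntegralNormalGen (E m) (θ m)) (r : ∀ m, PowerSeries (unitBall (E m)))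
    (G : ZMod d → PowerSeries (PowerSeries 𝒪[F])) : Prop :=
  ∀ m k, IsAmiceLevel p d hd σ₀ (hθ m) (fun j => PowerSeries.coeff k (G j)) (PowerSeries.coeff k (r m))

variable {p d hd σ₀}

/-- Unfolding `IsTransformProd` into the lane's inlined congruences. [cite: deShalit1987, Ch. I §3.8 (17)] -/
theorem isTransformProd_iff {θ : ∀ m, unitBall (E m)} (hθ : ∀ m, IsIntegralNormalGen (E m) (θ m)) (r : ∀ m, PowerSeries (unitBall (E m)))
    (G : ZMod d → PowerSeries (PowerSeries 𝒪[F])) :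
    IsTransformProd p d hd σ₀ hθ r G ↔ ∀ m k (j : ZMod d), ((1 + PowerSeries.X : PowerSeries 𝒪[F]) ^ p ^ m - 1) ∣
      PowerSeries.coeff k (G j) - ∑ i : ZMod (p ^ m), PowerSeries.C ((hθ m).basis.repr (PowerSeries.coeff k (r m))
        (((absoluteGaloisGroup.toAlgEquiv F σ₀).restrictNormal (E m)) ^ ((ZMod.chineseRemainder (hd.pow_right m)).symm (j, i)).val)) *
          (1 + PowerSeries.X) ^ i.val := Iff.rfl

/-- The integer base `ι_ℤ = C ∘ (LTCoeff.of F)⁻¹ : 𝒪_F → 𝒪_F⟦X⟧` of the transform's ambient ring. [cite: deShalit1987, Ch. I §3.8 (17)] -/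
abbrev intBase (F : Type) [Field F] [ValuativeRel F] [TopologicalSpace F] [IsNonarchimedeanLocalField F] : LTCoeff F →+* PowerSeries 𝒪[F] :=
  (PowerSeries.C (R := 𝒪[F])).comp (LTCoeff.of F).symm.toRingHom

omit hp in
/-- `ι_ℤ (LTCoeff.of F a) = C a`. [cite: deShalit1987, Ch. I §3.8 (17)] -/
@[simp] theorem intBase_of (a : 𝒪[F]) : intBase F (LTCoeff.of F a) = PowerSeries.C a := by
  change PowerSeries.C ((LTCoeff.of F).symm (LTCoeff.of F a)) = _
  rw [RingEquiv.symm_apply_apply]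

section Module
variable (u : (LTCoeff F)ˣ) (hu : LTCoeff.of F π = residueFieldCard F * u) (γ : 𝒪[F]ˣ)

/-- **`constTerm G`**: the `Y`-constant terms `j ↦ G_j(0) ∈ 𝒪_F⟦X⟧` of `G ∈ M = (𝒪_F⟦X⟧⟦Y⟧)^{ℤ/d}`. [cite: deShalit1987, Ch. I §3.8 (17)] -/
def constTerm (G : ZMod d → ColemanCoordModule hπ hq (intBase F) u hu γ) : ZMod d → PowerSeries 𝒪[F] :=
  fun j => PowerSeries.constantCoeff (TActModule.toPS (G j))

omit hp in
/-- Unfolding `constTerm`. [cite: deShalit1987, Ch. I §3.8 (17)] -/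
theorem constTerm_apply (G : ZMod d → ColemanCoordModule hπ hq (intBase F) u hu γ) (j : ZMod d) :
    constTerm hπ hq u hu γ G j = PowerSeries.constantCoeff (TActModule.toPS (G j)) := rfl

omit hp in
/-- `constTerm` is additive. [cite: deShalit1987, Ch. I §3.8 (17)] -/
theorem constTerm_add (G G' : ZMod d → ColemanCoordModule hπ hq (intBase F) u hu γ) :
    constTerm hπ hq u hu γ (G + G') = constTerm hπ hq u hu γ G + constTerm hπ hq u hu γ G' := by
  funext j
  rw [Pi.add_apply, constTerm_apply, Pi.add_apply, map_add, map_add]; rfl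

omit hp in
/-- `constTerm 0 = 0`. [cite: deShalit1987, Ch. I §3.8 (17)] -/
theorem constTerm_zero : constTerm hπ hq u hu γ (0 : ZMod d → ColemanCoordModule hπ hq (intBase F) u hu γ) = fun _ => 0 := by
  funext j
  rw [constTerm_apply, Pi.zero_apply]
  exact map_zero _

variable [IsAdicComplete (Ideal.span {intBase F (LTCoeff.of F π)}) (PowerSeries 𝒪[F])]

omit hp in
/-- **Scalars from the coefficient ring act on constant terms by multiplication**: `((C s) • G)⁰ = s·G⁰` (`s ∈ 𝒪_F⟦X⟧`).
[cite: deShalit1987, Ch. I §3.8 (17)] -/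
theorem constTerm_C_smul (s : PowerSeries 𝒪[F]) (G : ZMod d → ColemanCoordModule hπ hq (intBase F) u hu γ) :
    constTerm hπ hq u hu γ ((PowerSeries.C s : PowerSeries (PowerSeries 𝒪[F])) • G) = fun j => s * constTerm hπ hq u hu γ G j := by
  funext j
  rw [constTerm_apply, Pi.smul_apply, TActModule.C_smul, TActModule.toPS_ofPS, map_mul, PowerSeries.constantCoeff_C, constTerm_apply]

end Module

/-- `G(f)(0) = G(0)` when `f(0) = 0`. [folklore] -/
private theorem constantCoeff_subst_eq_constantCoeff {A : Type*} [CommRing A] {f : PowerSeries A} (hf : PowerSeries.constantCoeff f = 0)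
    (G : PowerSeries A) : PowerSeries.constantCoeff (G.subst f) = PowerSeries.constantCoeff G := by
  have hs : PowerSeries.HasSubst f := PowerSeries.HasSubst.of_constantCoeff_zero' hf
  have h := PowerSeries.constantCoeff_subst hs G
  rw [finsum_eq_single _ 0 (fun d hd => by
    rw [map_pow, show MvPowerSeries.constantCoeff f = PowerSeries.constantCoeff f from rfl, hf, zero_pow hd,
      smul_zero])] at h
  rw [pow_zero, map_one, PowerSeries.coeff_zero_eq_constantCoeff, smul_eq_mul, mul_one] at h
  exact h

/-- ★ **`(D_γ H)(0) = (ι γ − 1)·H(0)`** for the twist over any base (`ρ_γ(0) = 1`, `[γ]_f(0) = 0`). [cite: deShalit1987, Ch. I §3.4 Lemma (ii)] -/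
theorem constantCoeff_twistLinearBase {S : Type*} [CommRing S] (ι : LTCoeff F →+* S) (u : (LTCoeff F)ˣ) (hu : LTCoeff.of F π = residueFieldCard F * u)
    (v : 𝒪[F]ˣ) (H : PowerSeries S) :
    PowerSeries.constantCoeff (twistLinearBase hπ hq ι u v H) = (ι (LTCoeff.of F (v : 𝒪[F])) - 1) * PowerSeries.constantCoeff H := by
  have ht := two_eq_of_mul_inv hq u hu
  rw [twistLinearBase_apply, map_sub, map_mul, map_mul, PowerSeries.constantCoeff_C, ← PowerSeries.coeff_zero_eq_constantCoeff_apply,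
    PowerSeries.coeff_map, PowerSeries.coeff_zero_eq_constantCoeff_apply, constantCoeff_evenPartTwo_unitTwistSerTwo hπ hq ht, map_one, mul_one,
    constantCoeff_subst_eq_constantCoeff (constantCoeff_map_unitHom hπ ι v), sub_mul, one_mul]

/-- The constant term of an element of `I_K` lies in `(p^K)` (here `p = ι π`). [cite: deShalit1987, Ch. I §3.13 Lemma (proof)] -/
theorem constantCoeff_mem_of_mem_adicFiltGen {S : Type*} [CommRing S] {q : S} {K : ℕ} {H : PowerSeries S} (hH : H ∈ adicFiltGen q K) :
    PowerSeries.constantCoeff H ∈ Ideal.span {q ^ K} := by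
  have h := hH 0
  rwa [Nat.sub_zero, PowerSeries.coeff_zero_eq_constantCoeff] at h

section Module

variable (u : (LTCoeff F)ˣ) (hu : LTCoeff.of F π = residueFieldCard F * u) (γ : 𝒪[F]ˣ)
variable [IsAdicComplete (Ideal.span {intBase F (LTCoeff.of F π)}) (PowerSeries 𝒪[F])]

omit hp in
/-- ★ **`(T • G)⁰ = (γ − 1)·G⁰`**: the Lubin–Tate variable acts on constant terms through the scalar `γ − 1 ∈ 𝒪_F`.
[cite: deShalit1987, Ch. I §3.4 Lemma (ii), §3.8 (17)] -/
theorem constTerm_X_smul (G : ZMod d → ColemanCoordModule hπ hq (intBase F) u hu γ) :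
    constTerm hπ hq u hu γ ((PowerSeries.X : PowerSeries (PowerSeries 𝒪[F])) • G) =
      fun j => PowerSeries.C ((γ : 𝒪[F]) - 1) * constTerm hπ hq u hu γ G j := by
  funext j
  rw [constTerm_apply, Pi.smul_apply, TActModule.X_smul, TActModule.toPS_ofPS, constantCoeff_twistLinearBase hπ hq (intBase F) u hu γ,
    intBase_of, map_sub, map_one, constTerm_apply]

omit hp in
/-- `(T^k • G)⁰ = (γ − 1)^k·G⁰`. [cite: deShalit1987, Ch. I §3.8 (17)] -/
theorem constTerm_X_pow_smul (k : ℕ) (G : ZMod d → ColemanCoordModule hπ hq (intBase F) u hu γ) :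
    constTerm hπ hq u hu γ ((PowerSeries.X ^ k : PowerSeries (PowerSeries 𝒪[F])) • G) =
      fun j => PowerSeries.C (((γ : 𝒪[F]) - 1) ^ k) * constTerm hπ hq u hu γ G j := by
  induction k with
  | zero => funext j; rw [pow_zero, one_smul, pow_zero, map_one, one_mul]
  | succ k ih =>
    rw [pow_succ', mul_smul, constTerm_X_smul, ih]
    funext j
    dsimp only
    rw [← mul_assoc, ← map_mul, ← pow_succ']

/-! ### The unit twists and the Frobenius-shifts on `M`, and their constant terms -/

omit hp in
/-- **`(σ_v G)⁰ = v·G⁰`** (componentwise `σ_v = 1 + D_v`, `(D_v H)(0) = (v − 1)H(0)`). [cite: deShalit1987, Ch. I §3.4 Lemma (ii)] -/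
theorem constTerm_unitTwistₗ_compLeft (v : 𝒪[F]ˣ) (G : ZMod d → ColemanCoordModule hπ hq (intBase F) u hu γ) :
    constTerm hπ hq u hu γ ((unitTwistₗ hπ hq (intBase F) u hu γ v).compLeft (ZMod d) G) =
      fun j => PowerSeries.C (v : 𝒪[F]) * constTerm hπ hq u hu γ G j := by
  funext j
  rw [constTerm_apply, LinearMap.compLeft_apply, Function.comp_apply, toPS_unitTwistₗ, map_add,
    constantCoeff_twistLinearBase hπ hq (intBase F) u hu v, intBase_of, constTerm_apply]
  ring

/-- **The Frobenius-shift operator `(Φ_t G)(j) := (1+X)^t • G(j − t)`** on `M = (ColemanCoordModule)^{ℤ/d}` — the action of `φ^t`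
(`seriesProd_amice_frobPow`: shift of the `ℤ/d`-index ⊗ multiplication by `(1+X)^t`), a `Λ`-linear map.
[cite: deShalit1987, Ch. I §3.1, §3.8 (17)] -/
def frobShiftₗ (t : ℕ) : (ZMod d → ColemanCoordModule hπ hq (intBase F) u hu γ) →ₗ[PowerSeries (PowerSeries 𝒪[F])]
    (ZMod d → ColemanCoordModule hπ hq (intBase F) u hu γ) where
  toFun G j := (PowerSeries.C ((1 + PowerSeries.X) ^ t : PowerSeries 𝒪[F]) : PowerSeries (PowerSeries 𝒪[F])) • G (j - t)
  map_add' G G' := funext fun j => by rw [Pi.add_apply, smul_add]; rfl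
  map_smul' c G := funext fun j => by
    change _ = c • ((PowerSeries.C ((1 + PowerSeries.X) ^ t : PowerSeries 𝒪[F]) : PowerSeries (PowerSeries 𝒪[F])) • G (j - t))
    rw [Pi.smul_apply, smul_comm]

omit hp in
/-- Unfolding `frobShiftₗ`. [cite: deShalit1987, Ch. I §3.8 (17)] -/
theorem frobShiftₗ_apply (t : ℕ) (G : ZMod d → ColemanCoordModule hπ hq (intBase F) u hu γ) (j : ZMod d) :
    frobShiftₗ hπ hq u hu γ t G j = (PowerSeries.C ((1 + PowerSeries.X) ^ t : PowerSeries 𝒪[F]) : PowerSeries (PowerSeries 𝒪[F])) • G (j - t) :=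
  rfl

omit hp in
/-- `(Φ_t G)⁰(j) = (1+X)^t · G⁰(j − t)`. [cite: deShalit1987, Ch. I §3.8 (17)] -/
theorem constTerm_frobShiftₗ (t : ℕ) (G : ZMod d → ColemanCoordModule hπ hq (intBase F) u hu γ) :
    constTerm hπ hq u hu γ (frobShiftₗ hπ hq u hu γ t G) = fun j => (1 + PowerSeries.X) ^ t * constTerm hπ hq u hu γ G (j - t) := by
  funext j
  rw [constTerm_apply, frobShiftₗ_apply, TActModule.C_smul, TActModule.toPS_ofPS, map_mul, PowerSeries.constantCoeff_C, constTerm_apply]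

/-! ### §2. The image submodule -/

variable {θ : ∀ m, unitBall (E m)} (hθ : ∀ m, IsIntegralNormalGen (E m) (θ m))
  (hcoh : ∀ m, unitBallTrace (hmono (Nat.le_succ m)) (θ (m + 1)) = θ m)

variable {E} in
include hE hdeg hσ₀ in
/-- Admissibility is stable under the Frobenius-shift (`IsAmiceLevel.frobPow`; the anomaly range is `φ`-stable). [cite: deShalit1987, Ch. I §3.8 (17)] -/
theorem IsAdmissibleLevel.frobPow [NeZero d] {m : ℕ} {u' : 𝒪[F]} {x : ZMod d → PowerSeries 𝒪[F]}
    (h : IsAdmissibleLevel p d hd σ₀ (hθ m) u' x) (t : ℕ) : IsAdmissibleLevel p d hd σ₀ (hθ m) u' (fun j => (1 + PowerSeries.X) ^ t * x (j - t)) := by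
  obtain ⟨y, hy, hyR⟩ := h
  exact ⟨_, hy.frobPow hE hdeg hσ₀ t, unitBallEquiv_pow_mem_anomalyRange _ hyR⟩

variable (hd) in
include hE hdeg hσ₀ hcoh in
/-- ★★★ **The image of the two-variable Coleman transform as a `Λ`-SUBMODULE** of `M = (ColemanCoordModule)^{ℤ/d}`, `Λ = 𝒪_F⟦X⟧⟦T⟧`:
`unitsImage = {G : ∀ m, the level-m partner of G⁰ lies in (1 − uφ_m)𝒪_{E_m}}` (`exists_baseNormCoherent_principal_iff`'s image condition).
Closure under `Λ`: `λ • G ≡ Σ_{k<K} C(λ_k)·T^k • G (mod I_K)`; the finite part has constant terms `(Σ_k λ_k (γ−1)^k)·G⁰`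
(`IsAdmissibleLevel.C_mul`), the remainder constant terms in `(π^K)` with `K` the level-`m` anomaly exponent. [cite: deShalit1987, Ch. I §3.7, §3.8 (17); Ch. III §1.3] -/
def unitsImage [NeZero d] [CharZero F] [IsAdicComplete (Ideal.span {(p : 𝒪[F])}) 𝒪[F]] (hI : Ideal.span {(p : 𝒪[F])} ≠ ⊤)
    (hud : ∀ m, (u : LTCoeff F) ^ Module.finrank F (E m) ≠ 1) :
    Submodule (PowerSeries (PowerSeries 𝒪[F])) (ZMod d → ColemanCoordModule hπ hq (intBase F) u hu γ) where
  carrier := {G | ∀ m, IsAdmissibleLevel p d hd σ₀ (hθ m) ((LTCoeff.of F).symm (u : LTCoeff F)) (constTerm hπ hq u hu γ G)}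
  zero_mem' m := by
    rw [constTerm_zero]
    exact IsAdmissibleLevel.zero
  add_mem' {G G'} hG hG' m := by
    rw [constTerm_add]
    exact (hG m).add (hG' m)
  smul_mem' c G hG m := by
    -- the level-`m` anomaly exponent
    set u' : 𝒪[F] := (LTCoeff.of F).symm (u : LTCoeff F) with hu'
    have hud' : 1 - u' ^ Module.finrank F (E m) ≠ 0 := fun h => hud m (by
      have h' : u' ^ Module.finrank F (E m) = 1 := (sub_eq_zero.mp h).symm
      exact h')
    obtain ⟨K, hK⟩ := exists_pow_smul_mem_anomalyRange hπ (E' := E m) (hE m) hσ₀ u' hud'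
    -- split `c • G` into the partial sum and the remainder in `I_K`
    set D := twistLinearBase hπ hq (intBase F) u γ with hD
    have hDf := twistLinearBase_mem_adicFiltGen_succ hπ hq (intBase F) u hu γ
    have hrem : ∀ j, TActModule.toPS ((c • G) j) - tPartial D c (TActModule.toPS (G j)) K ∈ adicFiltGen (intBase F (LTCoeff.of F π)) K :=
      fun j => tAct_sub_tPartial_mem hDf c (TActModule.toPS (G j)) K
    -- constant terms of the partial sum: `s · G⁰` with `s = Σ_{k<K} c_k (γ−1)^k`
    have hpart : ∀ j, PowerSeries.constantCoeff (tPartial D c (TActModule.toPS (G j)) K) =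
        (∑ k ∈ range K, PowerSeries.coeff k c * PowerSeries.C (((γ : 𝒪[F]) - 1) ^ k)) * constTerm hπ hq u hu γ G j := by
      intro j
      rw [tPartial_def, map_sum, sum_mul]
      refine sum_congr rfl fun k _ => ?_
      have hk : (⇑D)^[k] (TActModule.toPS (G j)) = TActModule.toPS (((PowerSeries.X ^ k : PowerSeries (PowerSeries 𝒪[F]))) • G j) := by
        rw [TActModule.X_pow_smul, TActModule.toPS_ofPS]
      rw [map_mul, PowerSeries.constantCoeff_C, hk]
      have h2 := congrFun (constTerm_X_pow_smul hπ hq u hu γ k G) j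
      rw [constTerm_apply, Pi.smul_apply] at h2
      rw [h2, mul_assoc]
    -- constant terms of the remainder: multiples of `π^K`
    have hremc : ∀ j, ∃ z : PowerSeries 𝒪[F], PowerSeries.constantCoeff (TActModule.toPS ((c • G) j)) -
        PowerSeries.constantCoeff (tPartial D c (TActModule.toPS (G j)) K) = PowerSeries.C (π ^ K) * z := by
      intro j
      have h := constantCoeff_mem_of_mem_adicFiltGen (hrem j)
      rw [map_sub] at h
      change _ ∈ Ideal.span {PowerSeries.C π ^ K} at h
      rw [← map_pow] at h
      obtain ⟨z, hz⟩ := Ideal.mem_span_singleton'.mp h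
      exact ⟨z, by rw [← hz, mul_comm]⟩
    choose z hz using hremc
    -- a partner for `z` at level `m`
    obtain ⟨y', hy'⟩ := exists_isAmiceLevel hmono hE hdeg hσ₀ hI hθ hcoh z m
    -- assemble
    have e : constTerm hπ hq u hu γ (c • G) =
        (fun j => (∑ k ∈ range K, PowerSeries.coeff k c * PowerSeries.C (((γ : 𝒪[F]) - 1) ^ k)) * constTerm hπ hq u hu γ G j) +
          fun j => PowerSeries.C (π ^ K) * z j := by
      funext j
      rw [Pi.add_apply, constTerm_apply, ← hpart, ← hz, add_sub_cancel]
    rw [e]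
    exact ((hG m).C_mul hE hdeg hσ₀ hI _).add (IsAdmissibleLevel.of_pow_mul hK hy')

variable [NeZero d] [CharZero F] [IsAdicComplete (Ideal.span {(p : 𝒪[F])}) 𝒪[F]] (hI : Ideal.span {(p : 𝒪[F])} ≠ ⊤)
  (hud : ∀ m, (u : LTCoeff F) ^ Module.finrank F (E m) ≠ 1)

include hE hdeg hσ₀ hcoh in
/-- Membership in `unitsImage` (unfolding). [cite: deShalit1987, Ch. I §3.8 (17)] -/
theorem mem_unitsImage_iff (G : ZMod d → ColemanCoordModule hπ hq (intBase F) u hu γ) :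
    G ∈ unitsImage hd hπ E hmono hE hdeg hσ₀ hq u hu γ hθ hcoh hI hud ↔
      ∀ m, IsAdmissibleLevel p d hd σ₀ (hθ m) ((LTCoeff.of F).symm (u : LTCoeff F)) (constTerm hπ hq u hu γ G) := Iff.rfl

/-! ### §3. `N ≅ 𝒰¹_∞`: membership = being the transform of a principal norm-coherent unit family -/

include hE hdeg hσ₀ hcoh in
/-- ★★ **`G ∈ unitsImage` iff `G = Col β` for a baseNorm-coherent family `β` of PRINCIPAL norm-coherent units of the two-variable tower**
(unique by `eq_of_colemanTransformProd₂_eq`): the submodule `N` IS de Shalit's `i(𝒰 ⊗̂ 𝒪)` at `q = 2`, series side.  (→) the trace-coherent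
series family of `G` (`existsUnique_traceCoherent_series_of_seriesProd`) has its constant terms in the anomaly ranges (they are the level
partners of `G⁰`), so it is the coordinate family of a principal `β` (`exists_baseNormCoherent_principal_iff`); (←) `r_β(0) ∈ (1 − uφ)𝒪_{E_m}`
(`constantCoeff_relUnitCoordTwo`). [cite: deShalit1987, Ch. I §3.7 Theorem, §3.8 (16)–(17); Ch. III §1.3] -/
theorem mem_unitsImage_iff_exists_principal (hm : ∃ m₁ : ℕ, LTCoeff.of F π ^ 2 ∣ LTCoeff.of F π - m₁)
    (G : ZMod d → ColemanCoordModule hπ hq (intBase F) u hu γ) :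
    G ∈ unitsImage hd hπ E hmono hE hdeg hσ₀ hq u hu γ hθ hcoh hI hud ↔
      ∃ β : ∀ m, RelNormCoherentUnits hπ (E m),
        (∀ m, (β (m + 1)).baseNorm hπ (hmono (Nat.le_succ m)) = β m) ∧
        (∀ m, ‖(((β m).val 0 : unitBall (E m ⊔ ltField π 0 : IntermediateField F (AlgebraicClosure F))) :
          (E m ⊔ ltField π 0 : IntermediateField F (AlgebraicClosure F))) - 1‖ < 1) ∧
        IsTransformProd p d hd σ₀ hθ (fun m => relUnitCoordTwo hπ (E m) hq (hE m) hσ₀ u hu (β m)) (fun j => TActModule.toPS (G j)) := by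
  constructor
  · intro hG
    obtain ⟨r, ⟨hr, hrG⟩, -⟩ :=
      existsUnique_traceCoherent_series_of_seriesProd p d hd E hmono hE hdeg hσ₀ hI hθ hcoh (fun j => TActModule.toPS (G j))
    have hconst : ∀ m, ∃ c : unitBall (E m), PowerSeries.constantCoeff (r m) =
        c - algebraMap (LTCoeff F) (unitBall (E m)) u * (frobUnitBall (E m) σ₀ : unitBall (E m) →+* unitBall (E m)) c := by
      intro m
      have hlev : IsAmiceLevel p d hd σ₀ (hθ m) (constTerm hπ hq u hu γ G) (PowerSeries.constantCoeff (r m)) := by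
        intro j
        have h := hrG m 0 j
        simp only [PowerSeries.coeff_zero_eq_constantCoeff] at h
        exact h
      obtain ⟨c, hc⟩ := (hG m).mem_of_isAmiceLevel hE hdeg hσ₀ hI hlev
      exact ⟨c, by rw [hc, algebraMap_LTCoeff_eq_algebraMap]⟩
    obtain ⟨β, hβ, hβ1, hβr⟩ := (exists_baseNormCoherent_principal_iff hπ hq hσ₀ E hmono hE u hu hm hud r hr).mpr hconst
    refine ⟨β, hβ, hβ1, fun m k => ?_⟩
    dsimp only
    rw [hβr m]
    exact hrG m k
  · rintro ⟨β, -, -, hβG⟩ m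
    refine ⟨PowerSeries.constantCoeff (relUnitCoordTwo hπ (E m) hq (hE m) hσ₀ u hu (β m)), fun j => ?_, ?_⟩
    · have h := hβG m 0 j
      simp only [PowerSeries.coeff_zero_eq_constantCoeff] at h
      exact h
    · rw [mem_anomalyRange_iff]
      exact ⟨_, by rw [constantCoeff_relUnitCoordTwo, algebraMap_LTCoeff_eq_algebraMap]⟩

/-! ### §4. The cokernel `M/N` is cyclic over `𝒪_F`: `M = N + 𝒪_F·G₀` -/

include hE hdeg hσ₀ hcoh in
/-- ★★ **`∃ G₀ ∀ G ∃ a ∈ 𝒪_F, G − a·G₀ ∈ N`** (`a` acting as the scalar `C(C a) ∈ Λ`): the cokernel of `N ≤ M` is a CYCLIC `𝒪_F`-module —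
de Shalit's `𝒪(1)` of (17) — from `exists_cokernel_generator_colemanTransformProd₂`. [cite: deShalit1987, Ch. I §3.7 Theorem, §3.8 (17); Ch. III §1.3] -/
theorem exists_forall_sub_C_smul_mem_unitsImage (hm : ∃ m₁ : ℕ, LTCoeff.of F π ^ 2 ∣ LTCoeff.of F π - m₁) :
    ∃ G₀ : ZMod d → ColemanCoordModule hπ hq (intBase F) u hu γ, ∀ G : ZMod d → ColemanCoordModule hπ hq (intBase F) u hu γ,
      ∃ a : 𝒪[F], G - (PowerSeries.C (PowerSeries.C a) : PowerSeries (PowerSeries 𝒪[F])) • G₀ ∈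
        unitsImage hd hπ E hmono hE hdeg hσ₀ hq u hu γ hθ hcoh hI hud := by
  obtain ⟨G₀', hG₀'⟩ := exists_cokernel_generator_colemanTransformProd₂ p d hd hπ E hmono hE hdeg hσ₀ hq hI hθ hcoh u hu hm hud
  refine ⟨fun j => TActModule.ofPS _ _ (G₀' j), fun G => ?_⟩
  obtain ⟨a, β, hβ, hβ1, hβG⟩ := hG₀' (fun j => TActModule.toPS (G j))
  refine ⟨a, (mem_unitsImage_iff_exists_principal hπ E hmono hE hdeg hσ₀ hq u hu γ hθ hcoh hI hud hm _).mpr ⟨β, hβ, hβ1, fun m k j => ?_⟩⟩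
  have e : TActModule.toPS ((G - (PowerSeries.C (PowerSeries.C a) : PowerSeries (PowerSeries 𝒪[F])) •
      (fun j => TActModule.ofPS _ _ (G₀' j) : ZMod d → ColemanCoordModule hπ hq (intBase F) u hu γ)) j) =
      TActModule.toPS (G j) - PowerSeries.C (PowerSeries.C a) * G₀' j := by
    rw [Pi.sub_apply, Pi.smul_apply, map_sub, TActModule.C_smul, TActModule.toPS_ofPS, TActModule.toPS_ofPS]
  dsimp only
  rw [e]
  exact hβG m k j

include hE hdeg hσ₀ hcoh in
/-- **`N + Λ·G₀ = M`** (a fortiori, since `𝒪_F·G₀ ⊆ Λ·G₀`). [cite: deShalit1987, Ch. I §3.8 (17)] -/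
theorem exists_unitsImage_sup_span_eq_top (hm : ∃ m₁ : ℕ, LTCoeff.of F π ^ 2 ∣ LTCoeff.of F π - m₁) :
    ∃ G₀ : ZMod d → ColemanCoordModule hπ hq (intBase F) u hu γ,
      unitsImage hd hπ E hmono hE hdeg hσ₀ hq u hu γ hθ hcoh hI hud ⊔ Submodule.span (PowerSeries (PowerSeries 𝒪[F])) {G₀} = ⊤ := by
  obtain ⟨G₀, hG₀⟩ := exists_forall_sub_C_smul_mem_unitsImage hπ E hmono hE hdeg hσ₀ hq u hu γ hθ hcoh hI hud hm
  refine ⟨G₀, Submodule.eq_top_iff'.mpr fun G => ?_⟩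
  obtain ⟨a, ha⟩ := hG₀ G
  have e : G = (G - (PowerSeries.C (PowerSeries.C a) : PowerSeries (PowerSeries 𝒪[F])) • G₀) +
      (PowerSeries.C (PowerSeries.C a) : PowerSeries (PowerSeries 𝒪[F])) • G₀ := by rw [sub_add_cancel]
  rw [e]
  exact Submodule.add_mem_sup ha (Submodule.smul_mem _ _ (Submodule.subset_span rfl))

/-! ### §5. Equivariance: `N` is stable under the unit twists `σ_v` (`Δ` included) and under the Frobenius-shifts -/

include hE hdeg hσ₀ hcoh in
/-- ★ **`N` is stable under every unit twist `σ_v`, `v ∈ 𝒪_F^×`** (in particular under `Δ = {±1}`): with `coordBasisDelta` this makes `N` a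
`Λ[Δ]`-submodule. [cite: deShalit1987, Ch. I §3.4 Lemma (ii), §3.7; Ch. III §1.3] -/
theorem unitTwistₗ_compLeft_mem_unitsImage (v : 𝒪[F]ˣ) {G : ZMod d → ColemanCoordModule hπ hq (intBase F) u hu γ}
    (hG : G ∈ unitsImage hd hπ E hmono hE hdeg hσ₀ hq u hu γ hθ hcoh hI hud) :
    (unitTwistₗ hπ hq (intBase F) u hu γ v).compLeft (ZMod d) G ∈ unitsImage hd hπ E hmono hE hdeg hσ₀ hq u hu γ hθ hcoh hI hud := fun m => by
  rw [constTerm_unitTwistₗ_compLeft]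
  exact (hG m).smul (v : 𝒪[F])

include hE hdeg hσ₀ hcoh in
/-- ★ **`N` is stable under the Frobenius-shifts `Φ_t`** — together with the `Λ`-module structure (`ℤ_p × Γ'`), the unit twists (`Δ`), and
`IsAdmissibleLevel.C_mul`, `N` is a `Λ(𝒢)`-submodule for the FULL local Galois group `𝒢 = (ℤ/d × ℤ_p) × 𝒪_F^×`, matching the equivariance
`colemanTransformProd₂_galois_eq` of `Col`. [cite: deShalit1987, Ch. I §3.1, §3.8 (17); Ch. III §1.3] -/
theorem frobShiftₗ_mem_unitsImage (t : ℕ) {G : ZMod d → ColemanCoordModule hπ hq (intBase F) u hu γ}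
    (hG : G ∈ unitsImage hd hπ E hmono hE hdeg hσ₀ hq u hu γ hθ hcoh hI hud) :
    frobShiftₗ hπ hq u hu γ t G ∈ unitsImage hd hπ E hmono hE hdeg hσ₀ hq u hu γ hθ hcoh hI hud := fun m => by
  rw [constTerm_frobShiftₗ]
  exact (hG m).frobPow hE hdeg hσ₀ hθ t

end Module

end UnitsImageModuleTwo

end Literature.NumberTheory.GaloisRepresentations
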